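import Summits.NavierStokesRegularity.NavierStokesRegularity.Theorems.ExtremiserTransienceNearExtremalTransienceExtremiserLiouvilleConstantSpeedRellichTools
import HarnessLib

/-!
# Crux `ExtremiserTransience.NearExtremalTransience` (stmt-NavierStokesRegularity-21883), line `extremiser_liouville`,
# stub K1b — A RELLICH-TYPE COMPACTNESS CRITERION (weakly null + `H¹`-bounded on a ball ⇒ strongly null)

`--supports stmt-NavierStokesRegularity-21883` (helper).  Author: prover seat `ns-el-k1b` (g6).  The compactness step that record
§8 case (β) needs and Mathlib lacks, in the smooth self-contained form: if `Fₙ ∈ C¹(ℝ³;ℝ³)` have `∫⁻_{B(x₀,L+1)}(‖Fₙ‖ₑ² + ‖DFₙ‖ₑ²) ≤ A`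
and `∫⟪Fₙ, Φ⟫ → 0` for every continuous compactly supported `Φ`, then `∫⁻_{B(x₀,L)}‖Fₙ‖ₑ² → 0`.  Proof: split
`Fₙ = (Fₙ − φ_r ⋆ Fₙ) + φ_r ⋆ Fₙ`; the first piece has `L²(B)`-mass `≤ r²A` (`…RellichTools`), the second tends to `0` pointwise
(each value is a pairing with the test field `φ_r(x − ·)eᵢ`) and is bounded by `sup φ_r · A` (Jensen), so dominated convergence
applies on the ball.

* `enorm_normed_convolution_sq_le` : `‖(φ.normed ⋆ g)(x)‖ₑ² ≤ ∫⁻ φ.normed(t)‖g(x − t)‖ₑ² dt` (Jensen);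
* `tendsto_lintegral_ball_sq_of_weakNull` : the criterion above;
* `blowDown_window_false_of_H1bound` : the assembled (β)-kill (pairings-limit + `H¹` bound on a window + window energy ⇒ `False`);
* `lintegral_ball_fderiv_blowDown_sq` : the `H¹` bound in original variables is the RATE `∫⁻_{B(Rx₁,RL)}‖Dv‖ₑ² ≤ A/R`.

With `…BlowDownWindow` this turns §8(β)'s `H¹_loc` bound on a window directly into a contradiction.  WHAT THIS IS NOT: K1b is NOT
proved; nothing here proves NS regularity. [folklore]
-/

noncomputable section

open Set Filter Topology MeasureTheory Metric Function ContinuousLinearMap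
open scoped ENNReal NNReal Topology InnerProductSpace RealInnerProductSpace ContDiff Convolution
open Literature.Analysis.FluidPDE Literature.Analysis

namespace Summit.NavierStokesRegularity.NavierStokesRegularity.Theorems

-- the problem directory repeats the summit name (`NavierStokesRegularity/NavierStokesRegularity`)
set_option linter.dupNamespace false

namespace ExtremiserLiouville

open DepletionLadder.KStar DepletionLadder.KStar.HalfSpace

/-- **Jensen for mollified values**: `‖(φ.normed ⋆ g)(x)‖ₑ² ≤ ∫⁻ φ.normed(t) ‖g(x − t)‖ₑ² dt` for continuous `g`. [folklore] -/
theorem enorm_normed_convolution_sq_le (φ : ContDiffBump (0 : E3)) {g : E3 → E3} (hg : Continuous g) (x : E3) :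
    ‖(φ.normed volume ⋆[lsmul ℝ ℝ, volume] g) x‖ₑ ^ 2 ≤ ∫⁻ t, ENNReal.ofReal (φ.normed volume t) * ‖g (x - t)‖ₑ ^ 2 := by
  rw [convolution_def]
  simp only [lsmul_apply]
  set ν : Measure E3 := volume.withDensity fun t => ENNReal.ofReal (φ.normed volume t) with hν
  have hdm : Measurable fun t => ENNReal.ofReal (φ.normed volume t) :=
    ENNReal.measurable_ofReal.comp (φ.contDiff_normed (n := 0)).continuous.measurable
  have hν1 : ν univ ≤ 1 := by
    rw [hν, withDensity_apply _ MeasurableSet.univ, Measure.restrict_univ]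
    have h := FunctionSpaces.lintegral_enorm_normed (E := E3) φ
    have h' : ∀ y, ‖φ.normed volume y‖ₑ = ENNReal.ofReal (φ.normed volume y) := fun y =>
      Real.enorm_eq_ofReal (φ.nonneg_normed y)
    simp_rw [h'] at h
    exact h.le
  have hgm : Measurable fun t => ‖g (x - t)‖ₑ := (hg.comp (continuous_const.sub continuous_id)).measurable.enorm
  calc ‖∫ t, φ.normed volume t • g (x - t)‖ₑ ^ 2
      ≤ (∫⁻ t, ‖φ.normed volume t • g (x - t)‖ₑ) ^ 2 := pow_le_pow_left' (enorm_integral_le_lintegral_enorm _) 2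
    _ = (∫⁻ t, ‖g (x - t)‖ₑ ∂ν) ^ 2 := by
        rw [hν, lintegral_withDensity_eq_lintegral_mul _ hdm hgm]
        congr 1
        refine lintegral_congr fun t => ?_
        rw [Pi.mul_apply, enorm_smul, Real.enorm_eq_ofReal (φ.nonneg_normed t)]
    _ ≤ ∫⁻ t, ‖g (x - t)‖ₑ ^ 2 ∂ν := lintegral_sq_le_of_measure_univ_le_one ν hν1 hgm.aemeasurable
    _ = ∫⁻ t, ENNReal.ofReal (φ.normed volume t) * ‖g (x - t)‖ₑ ^ 2 := by
        rw [hν, lintegral_withDensity_eq_lintegral_mul _ hdm (hgm.pow_const 2)]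
        rfl

/-- Components of a mollified field are pairings with test fields: `⟪(φ.normed ⋆ g)(x), e⟫ = ∫ ⟪g y, φ.normed(x − y) e⟫ dy`.
[folklore] -/
theorem inner_normed_convolution_eq (φ : ContDiffBump (0 : E3)) {g : E3 → E3} (hg : Continuous g) (x e : E3) :
    ⟪(φ.normed volume ⋆[lsmul ℝ ℝ, volume] g) x, e⟫_ℝ = ∫ y, ⟪g y, φ.normed volume (x - y) • e⟫_ℝ := by
  rw [convolution_lsmul_swap]
  have hi : Integrable (fun y => φ.normed volume (x - y) • g y) volume := by
    refine Continuous.integrable_of_hasCompactSupport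
      (((φ.contDiff_normed (n := 0)).continuous.comp (continuous_const.sub continuous_id)).smul hg) ?_
    exact ((φ.hasCompactSupport_normed).comp_homeomorph (Homeomorph.subLeft x)).smul_right
  rw [real_inner_comm, ← integral_inner hi]
  refine integral_congr_ae (Eventually.of_forall fun y => ?_)
  simp only [real_inner_smul_right, real_inner_comm]

/-- `∫⁻_{B(0,r)} g(x − t) dt = ∫⁻_{B(x,r)} g`. [folklore] -/
theorem lintegral_ball_zero_comp_sub (g : E3 → ℝ≥0∞) (x : E3) (r : ℝ) :
    ∫⁻ t in ball (0 : E3) r, g (x - t) = ∫⁻ y in ball x r, g y := by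
  rw [← lintegral_indicator measurableSet_ball, ← lintegral_indicator measurableSet_ball]
  have h : (ball (0 : E3) r).indicator (fun t => g (x - t)) = fun t => (ball x r).indicator g (x - t) := by
    funext t
    have hiff : t ∈ ball (0 : E3) r ↔ x - t ∈ ball x r := by
      rw [mem_ball_zero_iff, mem_ball, dist_eq_norm, sub_sub_cancel_left, norm_neg]
    by_cases ht : t ∈ ball (0 : E3) r
    · rw [indicator_of_mem ht, indicator_of_mem (hiff.1 ht)]
    · rw [indicator_of_notMem ht, indicator_of_notMem (fun h => ht (hiff.2 h))]
  rw [h, lintegral_sub_left_eq_self]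

/-- `‖a‖ₑ² ≤ 4 (‖a − b‖ₑ² + ‖b‖ₑ²)`. [folklore] -/
theorem enorm_sq_le_four_mul (a b : E3) : ‖a‖ₑ ^ 2 ≤ 4 * (‖a - b‖ₑ ^ 2 + ‖b‖ₑ ^ 2) := by
  have h1 : ‖a‖ₑ ≤ ‖a - b‖ₑ + ‖b‖ₑ := by
    calc ‖a‖ₑ = ‖(a - b) + b‖ₑ := by rw [sub_add_cancel]
      _ ≤ ‖a - b‖ₑ + ‖b‖ₑ := enorm_add_le _ _
  set p : ℝ≥0∞ := ‖a - b‖ₑ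
  set q : ℝ≥0∞ := ‖b‖ₑ
  have h2 : p + q ≤ 2 * max p q := by rw [two_mul]; exact add_le_add (le_max_left _ _) (le_max_right _ _)
  have h3 : (max p q) ^ 2 ≤ p ^ 2 + q ^ 2 := by
    rcases le_total p q with h | h
    · rw [max_eq_right h]; exact le_add_self
    · rw [max_eq_left h]; exact le_self_add
  calc ‖a‖ₑ ^ 2 ≤ (p + q) ^ 2 := pow_le_pow_left' h1 2
    _ ≤ (2 * max p q) ^ 2 := pow_le_pow_left' h2 2
    _ = 4 * (max p q) ^ 2 := by rw [mul_pow]; norm_num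
    _ ≤ 4 * (p ^ 2 + q ^ 2) := mul_le_mul' le_rfl h3

/-- **Rellich-type criterion**: `Fₙ ∈ C¹(ℝ³;ℝ³)` weakly null (pairings with continuous compactly supported fields tend to `0`)
with `∫⁻_{B(x₀,L+1)} ‖Fₙ‖ₑ² ≤ A`, `∫⁻_{B(x₀,L+1)} ‖DFₙ‖ₑ² ≤ A` (`A < ∞`) ⟹ `∫⁻_{B(x₀,L)} ‖Fₙ‖ₑ² → 0`. [folklore] -/
theorem tendsto_lintegral_ball_sq_of_weakNull {F : ℕ → E3 → E3} (hF : ∀ n, ContDiff ℝ 1 (F n)) (x₀ : E3) (L : ℝ)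
    {A : ℝ≥0∞} (hA : A ≠ ⊤)
    (hF2 : ∀ n, ∫⁻ x in ball x₀ (L + 1), ‖F n x‖ₑ ^ 2 ≤ A)
    (hDF2 : ∀ n, ∫⁻ x in ball x₀ (L + 1), ‖fderiv ℝ (F n) x‖ₑ ^ 2 ≤ A)
    (hweak : ∀ Φ : E3 → E3, Continuous Φ → HasCompactSupport Φ →
      Tendsto (fun n => ∫ x, ⟪F n x, Φ x⟫_ℝ) atTop (𝓝 0)) :
    Tendsto (fun n => ∫⁻ x in ball x₀ L, ‖F n x‖ₑ ^ 2) atTop (𝓝 0) := by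
  have hFc : ∀ n, Continuous (F n) := fun n => (hF n).continuous
  rw [ENNReal.tendsto_nhds_zero]
  intro ε hε
  have hε2 : 0 < ε / 2 := ENNReal.half_pos hε.ne'
  -- choose the mollification radius `r ∈ (0,1]` with `4 r² A ≤ ε/2`
  obtain ⟨r, hr0, hr1, hrA⟩ : ∃ r : ℝ, 0 < r ∧ r ≤ 1 ∧ 4 * ENNReal.ofReal (r ^ 2) * A ≤ ε / 2 := by
    have hg : Tendsto (fun r : ℝ => 4 * ENNReal.ofReal (r ^ 2) * A) (𝓝 0) (𝓝 0) := by
      have h1 : Tendsto (fun r : ℝ => ENNReal.ofReal (r ^ 2)) (𝓝 0) (𝓝 0) := by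
        have h := (ENNReal.continuous_ofReal.comp (continuous_pow 2)).tendsto (0 : ℝ)
        simpa [Function.comp_def] using h
      have h2 := ENNReal.Tendsto.const_mul h1 (Or.inr ENNReal.ofNat_ne_top) (a := 4)
      rw [mul_zero] at h2
      have h3 := ENNReal.Tendsto.mul_const h2 (Or.inr hA) (b := A)
      rwa [zero_mul] at h3
    obtain ⟨δ, hδ, hδP⟩ := Metric.eventually_nhds_iff.1 (hg.eventually_lt_const hε2)
    refine ⟨min (δ / 2) 1, lt_min (by linarith) one_pos, min_le_right _ _, (hδP ?_).le⟩
    rw [dist_zero_right, Real.norm_eq_abs, abs_of_pos (lt_min (by linarith) one_pos)]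
    exact (min_le_left _ _).trans_lt (by linarith)
  set φ : ContDiffBump (0 : E3) := ⟨r / 2, r, by linarith, by linarith⟩ with hφ
  have hφr : φ.rOut = r := rfl
  -- the mollified pieces: bounded on the ball, pointwise to `0`
  obtain ⟨Φmax, hΦmax⟩ := (φ.contDiff_normed (n := 0) (μ := volume)).continuous.bounded_above_of_compact_support
    φ.hasCompactSupport_normed
  set m : ℕ → E3 → E3 := fun n => φ.normed volume ⋆[lsmul ℝ ℝ, volume] F n with hm
  have hconvc : ∀ n, Continuous (m n) := fun n =>
    (φ.hasCompactSupport_normed.contDiff_convolution_left _ (φ.contDiff_normed (n := 0))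
      (hFc n).locallyIntegrable).continuous
  have hbound : ∀ n, ∀ x ∈ ball x₀ L, ‖m n x‖ₑ ^ 2 ≤ ENNReal.ofReal Φmax * A := by
    intro n x hx
    refine (enorm_normed_convolution_sq_le φ (hFc n) x).trans ?_
    have hpt : ∀ t, ENNReal.ofReal (φ.normed volume t) * ‖F n (x - t)‖ₑ ^ 2 ≤
        (ball (0 : E3) r).indicator (fun t => ENNReal.ofReal Φmax * ‖F n (x - t)‖ₑ ^ 2) t := by
      intro t
      by_cases ht : t ∈ ball (0 : E3) r
      · rw [indicator_of_mem ht]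
        refine mul_le_mul' (ENNReal.ofReal_le_ofReal ((le_abs_self _).trans ?_)) le_rfl
        rw [← Real.norm_eq_abs]; exact hΦmax t
      · have h0 : φ.normed volume t = 0 := by
          by_contra hne
          have : t ∈ Function.support (φ.normed volume) := hne
          rw [φ.support_normed_eq] at this
          exact ht this
        rw [h0, ENNReal.ofReal_zero, zero_mul]; exact bot_le
    calc ∫⁻ t, ENNReal.ofReal (φ.normed volume t) * ‖F n (x - t)‖ₑ ^ 2
        ≤ ∫⁻ t, (ball (0 : E3) r).indicator (fun t => ENNReal.ofReal Φmax * ‖F n (x - t)‖ₑ ^ 2) t := lintegral_mono hpt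
      _ = ENNReal.ofReal Φmax * ∫⁻ y in ball x r, ‖F n y‖ₑ ^ 2 := by
          rw [lintegral_indicator measurableSet_ball, lintegral_const_mul' _ _ ENNReal.ofReal_ne_top,
            lintegral_ball_zero_comp_sub (fun y => ‖F n y‖ₑ ^ 2) x r]
      _ ≤ ENNReal.ofReal Φmax * A := by
          refine mul_le_mul' le_rfl ((lintegral_mono_set (ball_subset_ball' ?_)).trans (hF2 n))
          rw [mem_ball] at hx; linarith
  have hptw : ∀ x, Tendsto (fun n => m n x) atTop (𝓝 0) := by
    intro x
    set bs := stdOrthonormalBasis ℝ E3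
    have hinner : ∀ e : E3, Tendsto (fun n => ⟪m n x, e⟫_ℝ) atTop (𝓝 0) := by
      intro e
      have hΦc : Continuous fun y => φ.normed volume (x - y) • e :=
        ((φ.contDiff_normed (n := 0)).continuous.comp (continuous_const.sub continuous_id)).smul continuous_const
      have hΦs : HasCompactSupport fun y => φ.normed volume (x - y) • e :=
        ((φ.hasCompactSupport_normed).comp_homeomorph (Homeomorph.subLeft x)).smul_right
      have h := hweak _ hΦc hΦs
      refine h.congr fun n => ?_
      exact (inner_normed_convolution_eq φ (hFc n) x e).symm
    have hrepr : ∀ n, m n x = ∑ i, ⟪m n x, bs i⟫_ℝ • bs i := fun n => by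
      conv_lhs => rw [← bs.sum_repr' (m n x)]
      exact Finset.sum_congr rfl fun i _ => by rw [real_inner_comm]
    have hsum : Tendsto (fun n => ∑ i, ⟪m n x, bs i⟫_ℝ • bs i) atTop (𝓝 (∑ i, (0 : ℝ) • bs i)) :=
      tendsto_finsetSum _ fun i _ => (hinner (bs i)).smul_const (bs i)
    have h0 : ∑ i, (0 : ℝ) • bs i = (0 : E3) := by simp
    rw [h0] at hsum
    exact hsum.congr fun n => (hrepr n).symm
  have hb0 : Tendsto (fun n => ∫⁻ x in ball x₀ L, ‖m n x‖ₑ ^ 2) atTop (𝓝 0) := by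
    have h := tendsto_lintegral_of_dominated_convergence (μ := volume.restrict (ball x₀ L))
      (F := fun n x => ‖m n x‖ₑ ^ 2) (f := fun _ => 0) (fun _ => ENNReal.ofReal Φmax * A)
      (fun n => (hconvc n).measurable.enorm.pow_const 2)
      (fun n => (ae_restrict_mem measurableSet_ball).mono fun x hx => hbound n x hx)
      (by rw [setLIntegral_const]; exact ENNReal.mul_ne_top (ENNReal.mul_ne_top ENNReal.ofReal_ne_top hA) measure_ball_lt_top.ne)
      (Eventually.of_forall fun x => by
        have h1 := ((continuous_enorm.tendsto (0 : E3)).comp (hptw x))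
        have h2 := ((ENNReal.continuous_pow 2).tendsto _).comp h1
        rw [enorm_zero, zero_pow two_ne_zero] at h2
        exact h2)
    simpa using h
  have hev : ∀ᶠ n in atTop, 4 * ∫⁻ x in ball x₀ L, ‖m n x‖ₑ ^ 2 ≤ ε / 2 := by
    have h := ENNReal.Tendsto.const_mul hb0 (Or.inr ENNReal.ofNat_ne_top) (a := 4)
    rw [mul_zero] at h
    exact ENNReal.tendsto_nhds_zero.1 h (ε / 2) hε2
  -- assemble
  filter_upwards [hev] with n hn
  have hX : ∫⁻ x in ball x₀ L, ‖F n x - m n x‖ₑ ^ 2 ≤ ENNReal.ofReal (r ^ 2) * A := by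
    refine (lintegral_ball_sub_normed_convolution_sq_le φ (hF n) x₀ L).trans ?_
    rw [hφr]
    exact mul_le_mul' le_rfl ((lintegral_mono_set (ball_subset_ball (by linarith))).trans (hDF2 n))
  have hmeas1 : AEMeasurable (fun x => 4 * ‖F n x - m n x‖ₑ ^ 2) (volume.restrict (ball x₀ L)) :=
    ((((hFc n).sub (hconvc n)).measurable.enorm.pow_const 2).const_mul 4).aemeasurable
  calc ∫⁻ x in ball x₀ L, ‖F n x‖ₑ ^ 2
      ≤ ∫⁻ x in ball x₀ L, (4 * ‖F n x - m n x‖ₑ ^ 2 + 4 * ‖m n x‖ₑ ^ 2) :=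
        lintegral_mono fun x => (enorm_sq_le_four_mul (F n x) (m n x)).trans_eq (mul_add _ _ _)
    _ = 4 * (∫⁻ x in ball x₀ L, ‖F n x - m n x‖ₑ ^ 2) + 4 * ∫⁻ x in ball x₀ L, ‖m n x‖ₑ ^ 2 := by
        rw [lintegral_add_left' hmeas1, lintegral_const_mul' _ _ ENNReal.ofNat_ne_top,
          lintegral_const_mul' _ _ ENNReal.ofNat_ne_top]
    _ ≤ 4 * (ENNReal.ofReal (r ^ 2) * A) + ε / 2 := add_le_add (mul_le_mul' (le_refl (4 : ℝ≥0∞)) hX) hn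
    _ ≤ ε / 2 + ε / 2 := add_le_add (by rw [← mul_assoc]; exact hrA) le_rfl
    _ = ε := ENNReal.add_halves ε

/-- **The (β)-kill, assembled.**  Residue `(v, μ)` as in `blowDown_weakLimit_ae_eq_zero`; `Rₙ ≥ 1`, `Rₙ → ∞`; `U` a
pairings-limit of the blow-downs `Vₙ = Rₙ(v(Rₙ·) − c)` with sub-cubic growth.  If on some ball `B(x₁, L₁+1)` the blow-downs are
bounded in `H¹` (`∫⁻‖Vₙ‖ₑ², ∫⁻‖DVₙ‖ₑ² ≤ A < ∞` — record §8 case (β)) while `B(x₁, L₁)` carries energy `∫⁻‖Vₙ‖ₑ² ≥ e₀ > 0` (the jet's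
window), contradiction: `U = 0`, so `Vₙ` is weakly null, so `∫⁻_{B(x₁,L₁)}‖Vₙ‖ₑ² → 0` by the Rellich criterion.  (K1b itself is NOT
proved here: (β)'s `H¹` bound is the open analytic input.) [folklore] -/
theorem blowDown_window_false_of_H1bound {v : E3 → E3} {c : E3} (hv : ContDiff ℝ ∞ v) (hdiv : VectorCalculus.IsDivFree v)
    {M : ℝ} (hM : ∀ x, ‖v x‖ = M) (h1 : ∫⁻ x, ‖iteratedFDeriv ℝ 1 v x‖ₑ ^ 2 < ⊤) (h2 : ∫⁻ x, ‖iteratedFDeriv ℝ 2 v x‖ₑ ^ 2 < ⊤)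
    (hpos : 0 < M * Real.sqrt (Zen v) * Real.sqrt (Wpa v))
    (μ : Measure E3) [IsFiniteMeasure μ]
    (hμ : ∀ ψ : E3 → E3, ContDiff ℝ ∞ ψ → HasCompactSupport ψ → VectorCalculus.IsDivFree ψ →
      Jst v * J1 v ψ - kStar ^ 2 * M ^ 2 * (Wpa v * A1 v ψ + Zen v * C1 v ψ) = ∫ x, ⟪v x, ψ x⟫_ℝ ∂μ)
    (hc : c ≠ 0) (hcM : ‖c‖ = M) (hL6 : MemLp (fun x => v x - c) 6 volume)
    {Rn : ℕ → ℝ} (hRn1 : ∀ n, 1 ≤ Rn n) (hRn : Tendsto Rn atTop atTop)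
    {U : E3 → E3} (hU : AEStronglyMeasurable U volume) (hUl : LocallyIntegrable U volume)
    (hweak : ∀ Φ : E3 → E3, Continuous Φ → HasCompactSupport Φ →
      Tendsto (fun n => ∫ x, ⟪Rn n • (v (Rn n • x) - c), Φ x⟫_ℝ) atTop (𝓝 (∫ x, ⟪U x, Φ x⟫_ℝ)))
    {C θ : ℝ} (hC : 0 ≤ C) (hθ0 : 0 ≤ θ) (hθ : θ < 3)
    (hA : ∀ L : ℝ, 1 ≤ L → ∫⁻ x in ball (0 : E3) L, ‖U x‖ₑ ^ 2 ≤ ENNReal.ofReal (C * L ^ θ))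
    (x₁ : E3) (L₁ : ℝ) {A : ℝ≥0∞} (hAtop : A ≠ ⊤)
    (hV2 : ∀ n, ∫⁻ x in ball x₁ (L₁ + 1), ‖Rn n • (v (Rn n • x) - c)‖ₑ ^ 2 ≤ A)
    (hDV2 : ∀ n, ∫⁻ x in ball x₁ (L₁ + 1), ‖fderiv ℝ (fun x => Rn n • (v (Rn n • x) - c)) x‖ₑ ^ 2 ≤ A)
    {e₀ : ℝ} (he₀ : 0 < e₀) (hlow : ∀ n, ENNReal.ofReal e₀ ≤ ∫⁻ x in ball x₁ L₁, ‖Rn n • (v (Rn n • x) - c)‖ₑ ^ 2) :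
    False := by
  have hU0 : U =ᵐ[volume] 0 :=
    blowDown_weakLimit_ae_eq_zero hv hdiv hM h1 h2 hpos μ hμ hc hcM hL6 hRn1 hRn hU hUl hweak hC hθ0 hθ hA
  have hv1 : ContDiff ℝ 1 v := hv.of_le (by exact_mod_cast le_top)
  -- the blow-downs are weakly null
  have hnull : ∀ Φ : E3 → E3, Continuous Φ → HasCompactSupport Φ →
      Tendsto (fun n => ∫ x, ⟪Rn n • (v (Rn n • x) - c), Φ x⟫_ℝ) atTop (𝓝 0) := by
    intro Φ hΦ hΦc
    have h0 : ∫ x, ⟪U x, Φ x⟫_ℝ = 0 := by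
      rw [← integral_zero (α := E3) (G := ℝ)]
      refine integral_congr_ae ?_
      filter_upwards [hU0] with x hx
      rw [hx, Pi.zero_apply, inner_zero_left]
    exact h0 ▸ hweak Φ hΦ hΦc
  have hlim := tendsto_lintegral_ball_sq_of_weakNull (fun n => contDiff_blowDown hv1 c (Rn n)) x₁ L₁ hAtop hV2 hDV2 hnull
  have hle : ENNReal.ofReal e₀ ≤ 0 := ge_of_tendsto' hlim hlow
  exact absurd (le_antisymm hle bot_le) (ENNReal.ofReal_pos.2 he₀).ne'

/-- **`H¹`-mass of a blow-down on a ball, in original variables**: `∫⁻_{B(x₁,L)} ‖D[R(v(R·) − c)]‖ₑ² = R · ∫⁻_{B(Rx₁, RL)} ‖Dv‖ₑ²`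
(`R > 0`).  So (β)'s `H¹` bound on a window `B(x₁, L)` of the blow-downs is the RATE `∫_{B(Rₙx₁, RₙL)}‖Dv‖² ≤ A/Rₙ`. [folklore] -/
theorem lintegral_ball_fderiv_blowDown_sq {v : E3 → E3} (hv : Differentiable ℝ v) (c : E3) {R : ℝ} (hR : 0 < R)
    (x₁ : E3) (L : ℝ) :
    ∫⁻ x in ball x₁ L, ‖fderiv ℝ (fun x => R • (v (R • x) - c)) x‖ₑ ^ 2 =
      ENNReal.ofReal R * ∫⁻ y in ball (R • x₁) (R * L), ‖fderiv ℝ v y‖ₑ ^ 2 := by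
  have h1 : ∀ x, ‖fderiv ℝ (fun x => R • (v (R • x) - c)) x‖ₑ ^ 2 =
      ENNReal.ofReal ((R * R) ^ 2) * ‖fderiv ℝ v (R • x)‖ₑ ^ 2 := by
    intro x
    rw [fderiv_blowDown hv c R x, enorm_smul, mul_pow, Real.enorm_eq_ofReal (by positivity : (0 : ℝ) ≤ R * R),
      ENNReal.ofReal_pow (by positivity)]
  simp_rw [h1]
  rw [lintegral_const_mul' _ _ ENNReal.ofReal_ne_top, ← lintegral_indicator measurableSet_ball,
    ← lintegral_indicator measurableSet_ball]
  have h2 : (ball x₁ L).indicator (fun x => ‖fderiv ℝ v (R • x)‖ₑ ^ 2) =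
      fun x => (ball (R • x₁) (R * L)).indicator (fun y => ‖fderiv ℝ v y‖ₑ ^ 2) (R • x) := by
    funext x
    have hiff : x ∈ ball x₁ L ↔ R • x ∈ ball (R • x₁) (R * L) := by
      rw [mem_ball, mem_ball, dist_eq_norm, dist_eq_norm, ← smul_sub, norm_smul, Real.norm_eq_abs, abs_of_pos hR]
      exact ⟨fun h => mul_lt_mul_of_pos_left h hR, fun h => lt_of_mul_lt_mul_left h hR.le⟩
    by_cases hx : x ∈ ball x₁ L
    · rw [indicator_of_mem hx, indicator_of_mem (hiff.1 hx)]
    · rw [indicator_of_notMem hx, indicator_of_notMem (fun h => hx (hiff.2 h))]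
  rw [h2, lintegral_comp_smul_E3 _ hR, ← mul_assoc, ← ENNReal.ofReal_mul (by positivity)]
  congr 2
  field_simp

end ExtremiserLiouville

end Summit.NavierStokesRegularity.NavierStokesRegularity.Theorems

end
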